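import Summits.Ventures.HodgeRepro2.Sextic
import Summits.Ventures.HodgeRepro2.T4Identification

/-!
# T4Vertices — the vertex labels of the sign/orientation row (Tier 4, T4-B, README §6 item 2)

Seat p3 of the blind cell `pub-hodge-repro2` (Tier 4, README §6).  Imports seat p1's `Sextic.lean`
(the cube model of the rank-four faces) and p3's `T4Identification.lean`.

TIER4.md §B4(b) states, for the odd parity tetrahedron `F_odd = {111, 100, 010, 001}` in the cube
coordinates of TIER3 §5(g) (`b_ν = 1 ⟺ τ_ν ∈ T`) and the base embedding `τ₁ = τ_1`, that the
isotypic pieces of `111` and `100` are of Hodge type `(1,0)` at the `τ₁`-fibre and those of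
`010`, `001` of type `(0,1)`.  With Liu's convention «type `(1,0)` at `τ′` ⟺ `τ′ ∈ Φ_μ`», the
reflex relabelling `Φ_{μ_i} = T_i⁻¹` and `T4Identification.mem_inverseType_self_iff`, this is the
statement that the vertices of `F_odd` containing `τ₁` are exactly `111` and `100`, kernel-decided
here in p1's cube model (`oddTetra_coord_zero_filter`) and transported to the field level
(`holomorphic_oddTetra`, `antiholomorphic_oddTetra`): the holomorphic vertices at `τ₁` are
`i = 0, 1` (the types `111`, `100`), the anti-holomorphic ones `i = 2, 3` (`010`, `001`).  For the
even tetrahedron (the complex-conjugate face) the roles are exchanged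
(`evenTetra_coord_zero_filter`).

Axioms: propext, Classical.choice, Quot.sound.
-/

namespace Summit.Ventures.HodgeRepro2.T4Vertices

open NumberField
open Summit.Ventures.HodgeRepro2

/-- The vertices of the odd tetrahedron whose first coordinate is `1` (contain `τ₁`): `111` and
`100`, i.e. `i = 0, 1`. -/
theorem oddTetra_coord_zero_filter :
    (Finset.univ.filter fun i : Fin 4 => oddTetra i 0 = true) = {0, 1} := by decide

/-- The vertices of the odd tetrahedron whose first coordinate is `0` (contain `τ̄₁`): `010` and
`001`, i.e. `i = 2, 3`. -/
theorem oddTetra_coord_zero_filter_false :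
    (Finset.univ.filter fun i : Fin 4 => oddTetra i 0 = false) = {2, 3} := by decide

/-- For the even (complex-conjugate) tetrahedron the roles are exchanged: the vertices containing
`τ₁` are `i = 2, 3` (`101`, `110`). -/
theorem evenTetra_coord_zero_filter :
    (Finset.univ.filter fun i : Fin 4 => evenTetra i 0 = true) = {2, 3} := by decide

/-- The labels of the odd tetrahedron, for the record: `0 ↦ 111`, `1 ↦ 100`, `2 ↦ 010`,
`3 ↦ 001`. -/
theorem oddTetra_labels :
    oddTetra 0 = ![true, true, true] ∧ oddTetra 1 = ![true, false, false] ∧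
      oddTetra 2 = ![false, true, false] ∧ oddTetra 3 = ![false, false, true] := by
  decide

section Field

variable {K : Type*} [Field K] [NumberField K] [IsCMField K] [IsGalois ℚ K]

omit [NumberField K] [IsCMField K] [IsGalois ℚ K] in
/-- Field level: `τ₁ = τ 0` lies in the `i`-th vertex of the parity tetrahedron iff the cube
label has first coordinate `1`. -/
theorem mem_parityTetrahedron_iff {τ : Fin 3 → K →+* ℂ} (hinj : Function.Injective τ)
    (hcm : IsCMType K (Set.range τ)) (i : Fin 4) :
    τ 0 ∈ parityTetrahedron K τ i ↔ oddTetra i 0 = true := by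
  rw [parityTetrahedron_eq_cubeType]
  exact mem_cubeType_left hinj hcm _ 0

omit [NumberField K] [IsCMField K] [IsGalois ℚ K] in
/-- Field level: `τ̄₁` lies in the `i`-th vertex iff the first coordinate is `0`. -/
theorem conjugate_mem_parityTetrahedron_iff {τ : Fin 3 → K →+* ℂ} (hinj : Function.Injective τ)
    (hcm : IsCMType K (Set.range τ)) (i : Fin 4) :
    ComplexEmbedding.conjugate (τ 0) ∈ parityTetrahedron K τ i ↔ oddTetra i 0 = false := by
  rw [parityTetrahedron_eq_cubeType]
  exact mem_cubeType_right hinj hcm _ 0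

omit [IsCMField K] in
open Classical in
/-- TIER4 §B4(b), HOLOMORPHIC VERTICES: with `Φ_{μ_i} = T_i⁻¹` (base embedding `τ₁ = τ 0`) and
Liu's convention, the vertices of the parity tetrahedron whose piece is of type `(1,0)` at `τ₁` are
`i = 0, 1` — the types `111` and `100`. -/
theorem holomorphic_oddTetra {τ : Fin 3 → K →+* ℂ} (hinj : Function.Injective τ)
    (hcm : IsCMType K (Set.range τ)) :
    (Finset.univ.filter fun i : Fin 4 =>
      τ 0 ∈ inverseType K (τ 0) (parityTetrahedron K τ i)) = {0, 1} := by
  rw [← oddTetra_coord_zero_filter]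
  congr 1
  ext i
  simp [T4Identification.mem_inverseType_self_iff, mem_parityTetrahedron_iff hinj hcm]

open Classical in
/-- TIER4 §B4(b), ANTI-HOLOMORPHIC VERTICES: the vertices whose piece is of type `(0,1)` at `τ₁`
(equivalently `(1,0)` at `τ̄₁`, the opposite convention) are `i = 2, 3` — the types `010` and
`001`. -/
theorem antiholomorphic_oddTetra {τ : Fin 3 → K →+* ℂ} (hinj : Function.Injective τ)
    (hcm : IsCMType K (Set.range τ)) :
    (Finset.univ.filter fun i : Fin 4 =>
      ComplexEmbedding.conjugate (τ 0) ∈ inverseType K (τ 0) (parityTetrahedron K τ i)) =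
        {2, 3} := by
  rw [← oddTetra_coord_zero_filter_false]
  congr 1
  ext i
  simp [T4Identification.conjugate_mem_inverseType_iff, conjugate_mem_parityTetrahedron_iff hinj hcm]

end Field

end Summit.Ventures.HodgeRepro2.T4Vertices
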